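import Summits.QuantumFields.YangMills.Theorems.UnitScaleTiltFluctuationComparisonRegPrLiftFaceAvg
import Literature.LinearAlgebra.Matrix.UnitaryGroupExpSurjective

/-!
# Route `UnitScaleTilt` — crux K1bR-pr `FluctuationComparisonRegPr` (stmt-QuantumFields-19201), stub `stub_oneStepSmallLift`
# (W7 line), piece (L2), layer F4: THE COVARIANT EXPONENTIATED KERNEL LIFT `U⋆_V = exp(ζ_V) · faceSec V` OF A LINEAR FACE-SUPPORTED
# ONE-STEP LIFT, its sizes, and its (0.4) block average to second order from S-NEUTRALITY (support file `--supports stmt-QuantumFields-19201`)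

Fleet seat `ym-ust-19201-p1` gen 2 (CARD-19201-oneStepSmallLift-L1L2 §2–§3).  A face-supported linear one-step lift (the certified objects
`CertL3Face`, `CertL5`, … of the ym3-torus cell, re-expressed in TREE coordinates) is a finite table
`kz a p o k` = the coefficient, in the Lie-algebra correction `ζ(b)` on a fine bond `b` of direction `a` and in-block offsets `p`, of the
logarithm of the coarse plaquette of orientation `o` based at `blockOf b₋ + (k − R)` (`|k − R|∞ ≤ R`).  Non-abelian, covariant version:

* §1 coarse plaquette logarithms `clog V q = log V(∂q)` (series logarithm, `SU(N)`), canonical coarse STAIRCASE transports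
  `ctrans V y m = V(Γ¹_{y, y+m})`, conjugation `conjM`, the transported logarithms `wlog V y o k = Ad_{ctrans} clog`, and
  `expSU` (exponential of a traceless skew-Hermitian matrix as an element of `SU(N)`, `1` off that domain).
* §2 the correction `zeta kz V b = Σ_{o,k} kz(b.dir, offs b₋, o, k) • wlog V (blockOf b₋) o k`, the corrected configuration
  `corrE kz V b = expSU (zeta kz V b)` and the lift `U⋆ = corrE · faceSec V` (`kernelLift`).  Under `PlaqSmall δ V` (`δ ≤ 1/3`,
  `N·δ < π`): `zeta` is traceless skew-Hermitian (`coe_corrE`), `‖clog‖ ≤ 2δ`, `‖zeta‖ ≤ 2K₁δ` (`K₁` = an `ℓ¹` row-mass bound of the table),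
  `dist1 (corrE b) ≤ 4K₁δ`; a FACE-SUPPORTED table gives an exit-supported `corrE` (`exitSupported_corrE`).
* §3 **S-NEUTRALITY ⇒ ACCURACY**: if the face sums of the table vanish (`SNeutral`: `Σ_r kz a (r[a ↦ L−1]) o k = 0`, the certificates'
  `S ∘ Z′ = 0`), the face sums of `zeta` vanish EXACTLY (the transports and logarithms depend on the face only), so by layer F2
  **`mdist (V c) (Ū⋆(c)) ≤ (2K₁δ)² + 28(4K₁δ)²`** for every coarse bond (`mdist_avgFun_kernelLift_le`) — the accuracy clause of
  `ApproxLift.ApproxLiftStep` with `η = C·δ²`, NO gauge correction.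

The plaquette clause (row bounds modulo coarse 2-boundaries + the non-abelian Bianchi identity) is layer F5.  Elementary; nothing of
Bałaban's is asserted.
-/

noncomputable section

open scoped BigOperators Matrix.Norms.L2Operator
open NormedSpace

namespace Summit.QuantumFields.YangMills.Theorems.ApproxLift

open Literature.MathematicalPhysics.QuantumFieldTheory.Balaban1983to89
open T4Continuum BlockAveraging AveragingRT B10Eq47AxialChi BlockAveragingSection BlockAveragingSectionPlaq ExpMeanLog MatrixLog

variable {P : Params} {j : ℕ} {n : Type*} [Fintype n] [DecidableEq n] [Nonempty n]

/-! ## §1 Coarse plaquette logarithms, staircase transports, conjugation, `expSU` -/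

/-- An ORIENTATION of a plaquette: an ordered pair of directions `μ < ν`. -/
abbrev Orient (d : ℕ) : Type := {mn : Fin d × Fin d // mn.1 < mn.2}

/-- The in-block offsets of a fine site as an element of `{0,…,L−1}^d`. -/
def offs (x : Site P j) : Fin P.d → Fin P.L := fun i => ⟨offset x i, offset_lt x i⟩

/-- `offs (blockSite y r) = r` (standing range). -/
theorem offs_blockSite (hj : j + 1 ≤ P.m + P.K) (y : Site P (j + 1)) (r : Fin P.d → Fin P.L) : offs (Site.blockSite y r) = r := by
  funext i; apply Fin.ext; exact offset_blockSite hj y r i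

/-- A coarse site displaced by an integer vector (torus arithmetic). -/
def vadd (y : Site P (j + 1)) (m : Fin P.d → ℤ) : Site P (j + 1) := fun i => y i + ((m i : ℤ) : ZMod (P.sitesPerDir (j + 1)))

/-- The integer vector `k − R` encoded by `k ∈ {0,…,2R}^d`. -/
def kvec (R : ℕ) {d : ℕ} (k : Fin d → Fin (2 * R + 1)) : Fin d → ℤ := fun i => ((k i : ℕ) : ℤ) - R

/-- The coarse plaquette of orientation `o` based at `y + m`. -/
def plaqAt (y : Site P (j + 1)) (m : Fin P.d → ℤ) (o : Orient P.d) : Plaq P (j + 1) := ⟨vadd y m, o.1.1, o.1.2, o.2⟩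

/-- In the model, `dist1 g = ‖g − 1‖`. -/
private theorem dist1_su_eq'' (g : Matrix.specialUnitaryGroup n ℂ) : dist1 g = ‖(g : Matrix n n ℂ) - 1‖ := rfl

/-- A special unitary matrix has operator norm `≤ 1`. -/
private theorem norm_coe_su_le_one'' (g : Matrix.specialUnitaryGroup n ℂ) : ‖(g : Matrix n n ℂ)‖ ≤ 1 :=
  (UnitaryModel.norm_of_mem_unitaryGroup (Matrix.specialUnitaryGroup_le_unitaryGroup g.2)).le

/-- **COARSE PLAQUETTE LOGARITHM** `log V(∂q)` (the series logarithm of the tree, based at `q₋`). -/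
def clog (V : GaugeField P (j + 1) (Matrix.specialUnitaryGroup n ℂ)) (q : Plaq P (j + 1)) : Matrix n n ℂ :=
  mlog ((GaugeField.plaqHol V q : Matrix.specialUnitaryGroup n ℂ) : Matrix n n ℂ)

/-- CONJUGATION `Ad_g X = g X g⁻¹` by a group element, on matrices. -/
def conjM (g : Matrix.specialUnitaryGroup n ℂ) (X : Matrix n n ℂ) : Matrix n n ℂ :=
  (g : Matrix n n ℂ) * X * ((g⁻¹ : Matrix.specialUnitaryGroup n ℂ) : Matrix n n ℂ)

/-- **THE CANONICAL COARSE TRANSPORT** from `y` to `y + m`: the holonomy of `V` along the staircase `Γ¹_{y, y+m}` (axes in their natural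
order). -/
def ctrans (V : GaugeField P (j + 1) (Matrix.specialUnitaryGroup n ℂ)) (y : Site P (j + 1)) (m : Fin P.d → ℤ) :
    Matrix.specialUnitaryGroup n ℂ :=
  holAt V (walk y (stairWord 1 m))

/-- **THE TRANSPORTED LOGARITHM** of the coarse plaquette `(o; y + (k − R))`, expressed in the frame at `y`. -/
def wlog (R : ℕ) (V : GaugeField P (j + 1) (Matrix.specialUnitaryGroup n ℂ)) (y : Site P (j + 1)) (o : Orient P.d)
    (k : Fin P.d → Fin (2 * R + 1)) : Matrix n n ℂ :=
  conjM (ctrans V y (kvec R k)) (clog V (plaqAt y (kvec R k) o))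

open Classical in
/-- The exponential of a traceless skew-Hermitian matrix as an element of `SU(N)`; `1` off that domain (total extension). -/
def expSU (X : Matrix n n ℂ) : Matrix.specialUnitaryGroup n ℂ :=
  if h : X ∈ skewAdjoint (Matrix n n ℂ) ∧ X.trace = 0 then
    ⟨exp X, Literature.LinearAlgebra.Matrix.exp_mem_specialUnitaryGroup_of_mem_skewAdjoint h.1 h.2⟩ else 1

omit [Nonempty n] in
/-- On its domain `expSU X = exp X`. -/
theorem coe_expSU {X : Matrix n n ℂ} (hX : X ∈ skewAdjoint (Matrix n n ℂ)) (htr : X.trace = 0) :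
    ((expSU X : Matrix.specialUnitaryGroup n ℂ) : Matrix n n ℂ) = exp X := by
  unfold expSU; rw [dif_pos ⟨hX, htr⟩]

omit [Nonempty n] in
/-- `expSU 0 = 1`. -/
theorem expSU_zero : expSU (0 : Matrix n n ℂ) = 1 := by
  apply Subtype.ext
  rw [coe_expSU (zero_mem _) (Matrix.trace_zero n ℂ), exp_zero]
  rfl

/-! ### sizes and the Lie algebra -/

/-- `‖log V(∂q)‖ ≤ 2δ` for a `δ`-small `V`, `δ ≤ 1/2`. -/
theorem norm_clog_le {δ : ℝ} {V : GaugeField P (j + 1) (Matrix.specialUnitaryGroup n ℂ)} (hV : PlaqSmall δ V) (hδ : δ ≤ 1 / 2)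
    (q : Plaq P (j + 1)) : ‖clog V q‖ ≤ 2 * δ := by
  have h := hV q
  rw [dist1_su_eq''] at h
  exact (norm_mlog_le_two_mul (h.le.trans hδ)).trans (by linarith)

/-- `log V(∂q)` is traceless skew-Hermitian for a `δ`-small `V`, `δ ≤ 1/3`, `N·δ < π`. -/
theorem clog_mem {δ : ℝ} {V : GaugeField P (j + 1) (Matrix.specialUnitaryGroup n ℂ)} (hV : PlaqSmall δ V) (hδ : δ ≤ 1 / 3)
    (hπ : Fintype.card n * δ < Real.pi) (q : Plaq P (j + 1)) :
    clog V q ∈ skewAdjoint (Matrix n n ℂ) ∧ (clog V q).trace = 0 := by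
  have h := hV q
  rw [dist1_su_eq''] at h
  refine ⟨?_, trace_mlog_eq_zero (GaugeField.plaqHol V q).2 (h.le.trans hδ) ?_⟩
  · exact star_mlog_eq_neg (Matrix.specialUnitaryGroup_le_unitaryGroup (GaugeField.plaqHol V q).2) (h.le.trans hδ)
  · exact lt_of_le_of_lt (mul_le_mul_of_nonneg_left h.le (Nat.cast_nonneg _)) hπ

/-- Conjugation is an isometry-bound: `‖Ad_g X‖ ≤ ‖X‖`. -/
theorem norm_conjM_le (g : Matrix.specialUnitaryGroup n ℂ) (X : Matrix n n ℂ) : ‖conjM g X‖ ≤ ‖X‖ := by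
  unfold conjM
  calc _ ≤ ‖(g : Matrix n n ℂ) * X‖ * ‖((g⁻¹ : Matrix.specialUnitaryGroup n ℂ) : Matrix n n ℂ)‖ := norm_mul_le _ _
    _ ≤ ‖(g : Matrix n n ℂ)‖ * ‖X‖ * 1 := mul_le_mul (norm_mul_le _ _) (norm_coe_su_le_one'' _) (norm_nonneg _) (by positivity)
    _ ≤ 1 * ‖X‖ * 1 := by gcongr; exact norm_coe_su_le_one'' _
    _ = ‖X‖ := by ring

omit [Nonempty n] in
/-- `↑g⁻¹ * ↑g = 1` in the matrix model. -/
private theorem coe_inv_mul_coe'' (g : Matrix.specialUnitaryGroup n ℂ) :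
    ((g⁻¹ : Matrix.specialUnitaryGroup n ℂ) : Matrix n n ℂ) * (g : Matrix n n ℂ) = 1 := by
  rw [← Submonoid.coe_mul, inv_mul_cancel]; rfl

omit [Nonempty n] in
/-- Conjugation preserves the Lie algebra `𝔰𝔲(N)`. -/
theorem conjM_mem (g : Matrix.specialUnitaryGroup n ℂ) {X : Matrix n n ℂ} (hX : X ∈ skewAdjoint (Matrix n n ℂ) ∧ X.trace = 0) :
    conjM g X ∈ skewAdjoint (Matrix n n ℂ) ∧ (conjM g X).trace = 0 := by
  obtain ⟨hs, ht⟩ := hX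
  rw [skewAdjoint.mem_iff] at hs ⊢
  have hinv : ((g⁻¹ : Matrix.specialUnitaryGroup n ℂ) : Matrix n n ℂ) = star (g : Matrix n n ℂ) := rfl
  refine ⟨?_, ?_⟩
  · unfold conjM
    rw [star_mul, star_mul, hinv, star_star, hs, ← mul_assoc, mul_neg, neg_mul]
  · unfold conjM
    rw [Matrix.trace_mul_cycle, coe_inv_mul_coe'', one_mul, ht]

omit [DecidableEq n] [Nonempty n] in
/-- The Lie algebra `𝔰𝔲(N)` (traceless skew-Hermitian matrices) is closed under real linear combinations. -/
theorem sum_smul_mem_su {ι : Type*} (S : Finset ι) (c : ι → ℝ) (X : ι → Matrix n n ℂ)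
    (hX : ∀ i ∈ S, X i ∈ skewAdjoint (Matrix n n ℂ) ∧ (X i).trace = 0) :
    (∑ i ∈ S, ((c i : ℝ) : ℂ) • X i) ∈ skewAdjoint (Matrix n n ℂ) ∧ (∑ i ∈ S, ((c i : ℝ) : ℂ) • X i).trace = 0 := by
  refine ⟨AddSubgroup.sum_mem _ fun i hi => ?_, ?_⟩
  · have h := (hX i hi).1
    rw [skewAdjoint.mem_iff] at h ⊢
    rw [star_smul, h, Complex.star_def, Complex.conj_ofReal, smul_neg]
  · rw [Matrix.trace_sum]
    exact Finset.sum_eq_zero fun i hi => by rw [Matrix.trace_smul, (hX i hi).2, smul_zero]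

/-! ## §2 The kernel correction `ζ`, the corrected configuration and the lift -/

section Kernel

variable (R : ℕ) (kz : Fin P.d → (Fin P.d → Fin P.L) → Orient P.d → (Fin P.d → Fin (2 * R + 1)) → ℝ)

/-- **THE LIE-ALGEBRA CORRECTION** on the fine bond `b`: `ζ(b) = Σ_{o,k} kz(b.dir, offs b₋, o, k) • Ad_{V(Γ¹)} log V(∂(o; blockOf b₋ + k − R))`
— the linear lift applied to the transported coarse plaquette logarithms, all expressed in the frame at `blockOf b₋`. -/
def zeta (V : GaugeField P (j + 1) (Matrix.specialUnitaryGroup n ℂ)) (b : PBond P j) : Matrix n n ℂ :=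
  ∑ o : Orient P.d, ∑ k : Fin P.d → Fin (2 * R + 1), ((kz b.dir (offs b.src) o k : ℝ) : ℂ) • wlog R V (blockOf b.src) o k

/-- **THE CORRECTION** `E(b) = exp ζ(b) ∈ SU(N)`. -/
def corrE (V : GaugeField P (j + 1) (Matrix.specialUnitaryGroup n ℂ)) : GaugeField P j (Matrix.specialUnitaryGroup n ℂ) :=
  fun b => expSU (zeta R kz V b)

/-- **THE KERNEL LIFT** `U⋆_V = exp(ζ_V) · faceSec V`. -/
def kernelLift (V : GaugeField P (j + 1) (Matrix.specialUnitaryGroup n ℂ)) : GaugeField P j (Matrix.specialUnitaryGroup n ℂ) :=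
  mulField (corrE R kz V) (faceSec V)

/-- The table is FACE-SUPPORTED: no coefficient on a bond that does not exit its block. -/
def FaceSupported : Prop := ∀ a p o k, (p a : ℕ) ≠ P.L - 1 → kz a p o k = 0

/-- The table is S-NEUTRAL: its face sums vanish (the certificates' `S ∘ Z′ = 0`; each exit bond of a face is met `L` times by
`r ↦ r[a ↦ L−1]`). -/
def SNeutral : Prop := ∀ a o k, ∑ r : Fin P.d → Fin P.L, kz a (Function.update r a (lastPos P)) o k = 0

/-- An `ℓ¹` ROW-MASS bound of the table. -/
def RowMass (K₁ : ℝ) : Prop := ∀ a p, ∑ o : Orient P.d, ∑ k : Fin P.d → Fin (2 * R + 1), |kz a p o k| ≤ K₁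

variable {R kz}

/-- `ζ(b) ∈ 𝔰𝔲(N)` on small fields. -/
theorem zeta_mem {δ : ℝ} {V : GaugeField P (j + 1) (Matrix.specialUnitaryGroup n ℂ)} (hV : PlaqSmall δ V) (hδ : δ ≤ 1 / 3)
    (hπ : Fintype.card n * δ < Real.pi) (b : PBond P j) :
    zeta R kz V b ∈ skewAdjoint (Matrix n n ℂ) ∧ (zeta R kz V b).trace = 0 := by
  unfold zeta
  have h : ∀ o : Orient P.d, (∑ k : Fin P.d → Fin (2 * R + 1), ((kz b.dir (offs b.src) o k : ℝ) : ℂ) • wlog R V (blockOf b.src) o k) ∈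
      skewAdjoint (Matrix n n ℂ) ∧
      (∑ k : Fin P.d → Fin (2 * R + 1), ((kz b.dir (offs b.src) o k : ℝ) : ℂ) • wlog R V (blockOf b.src) o k).trace = 0 := fun o =>
    sum_smul_mem_su _ _ _ fun k _ => conjM_mem _ (clog_mem hV hδ hπ _)
  refine ⟨AddSubgroup.sum_mem _ fun o _ => (h o).1, ?_⟩
  rw [Matrix.trace_sum]
  exact Finset.sum_eq_zero fun o _ => (h o).2

/-- On small fields `E(b) = exp ζ(b)` as a matrix. -/
theorem coe_corrE {δ : ℝ} {V : GaugeField P (j + 1) (Matrix.specialUnitaryGroup n ℂ)} (hV : PlaqSmall δ V) (hδ : δ ≤ 1 / 3)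
    (hπ : Fintype.card n * δ < Real.pi) (b : PBond P j) :
    ((corrE R kz V b : Matrix.specialUnitaryGroup n ℂ) : Matrix n n ℂ) = exp (zeta R kz V b) :=
  coe_expSU (zeta_mem hV hδ hπ b).1 (zeta_mem hV hδ hπ b).2

/-- `‖wlog‖ ≤ 2δ`. -/
theorem norm_wlog_le {δ : ℝ} {V : GaugeField P (j + 1) (Matrix.specialUnitaryGroup n ℂ)} (hV : PlaqSmall δ V) (hδ : δ ≤ 1 / 2)
    (y : Site P (j + 1)) (o : Orient P.d) (k : Fin P.d → Fin (2 * R + 1)) : ‖wlog R V y o k‖ ≤ 2 * δ :=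
  (norm_conjM_le _ _).trans (norm_clog_le hV hδ _)

/-- **SIZE OF THE CORRECTION**: `‖ζ(b)‖ ≤ K₁ · 2δ`. -/
theorem norm_zeta_le {δ K₁ : ℝ} {V : GaugeField P (j + 1) (Matrix.specialUnitaryGroup n ℂ)} (hδ0 : 0 ≤ δ) (hV : PlaqSmall δ V)
    (hδ : δ ≤ 1 / 2) (hK : RowMass R kz K₁) (b : PBond P j) : ‖zeta R kz V b‖ ≤ K₁ * (2 * δ) := by
  unfold zeta
  calc _ ≤ ∑ o : Orient P.d, ‖∑ k : Fin P.d → Fin (2 * R + 1), ((kz b.dir (offs b.src) o k : ℝ) : ℂ) • wlog R V (blockOf b.src) o k‖ :=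
        norm_sum_le _ _
    _ ≤ ∑ o : Orient P.d, ∑ k : Fin P.d → Fin (2 * R + 1), |kz b.dir (offs b.src) o k| * (2 * δ) := by
        refine Finset.sum_le_sum fun o _ => (norm_sum_le _ _).trans (Finset.sum_le_sum fun k _ => ?_)
        rw [norm_smul, Complex.norm_real, Real.norm_eq_abs]
        exact mul_le_mul_of_nonneg_left (norm_wlog_le hV hδ _ _ _) (abs_nonneg _)
    _ = (∑ o : Orient P.d, ∑ k : Fin P.d → Fin (2 * R + 1), |kz b.dir (offs b.src) o k|) * (2 * δ) := by
        rw [Finset.sum_mul]; exact Finset.sum_congr rfl fun o _ => by rw [Finset.sum_mul]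
    _ ≤ K₁ * (2 * δ) := mul_le_mul_of_nonneg_right (hK _ _) (by linarith)

/-- **SIZE OF `E − 1`**: `dist1 (E b) ≤ 2s` whenever `‖ζ(b)‖ ≤ s ≤ 1` (small fields). -/
theorem dist1_corrE_le {δ s : ℝ} {V : GaugeField P (j + 1) (Matrix.specialUnitaryGroup n ℂ)} (hV : PlaqSmall δ V) (hδ : δ ≤ 1 / 3)
    (hπ : Fintype.card n * δ < Real.pi) {b : PBond P j} (hs : ‖zeta R kz V b‖ ≤ s) (hs1 : s ≤ 1) :
    dist1 (corrE R kz V b) ≤ 2 * s := by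
  rw [dist1_su_eq'', coe_corrE hV hδ hπ]
  letI : NormedAlgebra ℝ (Matrix n n ℂ) := NormedAlgebra.restrictScalars ℝ ℂ (Matrix n n ℂ)
  have s0 : 0 ≤ s := (norm_nonneg _).trans hs
  have h := Literature.MathematicalPhysics.QuantumFieldTheory.OneLinkLaplace.norm_exp_sub_one_sub_le_sq (hs.trans hs1)
  have h2 : exp (zeta R kz V b) - 1 = (exp (zeta R kz V b) - 1 - zeta R kz V b) + zeta R kz V b := by abel
  rw [h2]
  calc _ ≤ ‖exp (zeta R kz V b) - 1 - zeta R kz V b‖ + ‖zeta R kz V b‖ := norm_add_le _ _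
    _ ≤ ‖zeta R kz V b‖ ^ 2 + ‖zeta R kz V b‖ := add_le_add h le_rfl
    _ ≤ s ^ 2 + s := by gcongr
    _ ≤ s * 1 + s := by rw [sq]; gcongr
    _ = 2 * s := by ring

/-- A bond exits its block iff its in-block offset in its own direction is `L − 1`. -/
theorem exitsBlock_iff_offs (b : PBond P j) : ExitsBlock b ↔ (offs b.src b.dir : ℕ) = P.L - 1 := exitsBlock_iff b

/-- **A FACE-SUPPORTED TABLE GIVES AN EXIT-SUPPORTED CORRECTION** (`ζ = 0`, `E = 1` off the exit bonds). -/
theorem zeta_eq_zero_of_not_exits (hF : FaceSupported R kz) (V : GaugeField P (j + 1) (Matrix.specialUnitaryGroup n ℂ))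
    {b : PBond P j} (hb : ¬ ExitsBlock b) : zeta R kz V b = 0 := by
  rw [exitsBlock_iff_offs] at hb
  unfold zeta
  exact Finset.sum_eq_zero fun o _ => Finset.sum_eq_zero fun k _ => by rw [hF _ _ _ _ hb]; simp

/-- Hence `corrE` is exit-supported. -/
theorem exitSupported_corrE (hF : FaceSupported R kz) (V : GaugeField P (j + 1) (Matrix.specialUnitaryGroup n ℂ)) :
    ExitSupported (corrE R kz V) := fun b hb => by
  show expSU (zeta R kz V b) = 1
  rw [zeta_eq_zero_of_not_exits hF V hb, expSU_zero]

/-! ## §3 S-neutrality: the face sums of `ζ` vanish exactly, hence the block average of the lift is `V` to second order -/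

/-- The correction on the exit bond of the face of `c` at offsets `r`: the table row at `r[c.dir ↦ L−1]` against the transported
logarithms AT THE FACE (`blockOf = c₋`, independent of `r`). -/
theorem zeta_exitBond (hj : j + 1 ≤ P.m + P.K) (V : GaugeField P (j + 1) (Matrix.specialUnitaryGroup n ℂ)) (c : PBond P (j + 1))
    (r : Fin P.d → Fin P.L) :
    zeta R kz V (exitBond c r) = ∑ o : Orient P.d, ∑ k : Fin P.d → Fin (2 * R + 1),
      ((kz c.dir (Function.update r c.dir (lastPos P)) o k : ℝ) : ℂ) • wlog R V c.src o k := by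
  unfold zeta
  have h1 : offs (exitBond c r).src = Function.update r c.dir (lastPos P) := offs_blockSite hj _ _
  have h2 : blockOf (exitBond c r).src = c.src := blockOf_exitBond_src hj c r
  rw [h1, h2]
  rfl

/-- **THE FACE SUMS OF `ζ` VANISH** for an S-neutral table. -/
theorem faceSum_zeta_eq_zero (hj : j + 1 ≤ P.m + P.K) (hS : SNeutral R kz) (V : GaugeField P (j + 1) (Matrix.specialUnitaryGroup n ℂ))
    (c : PBond P (j + 1)) : ∑ r : Fin P.d → Fin P.L, zeta R kz V (exitBond c r) = 0 := by
  simp_rw [zeta_exitBond hj V c]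
  rw [Finset.sum_comm]
  refine Finset.sum_eq_zero fun o _ => ?_
  rw [Finset.sum_comm]
  refine Finset.sum_eq_zero fun k _ => ?_
  rw [← Finset.sum_smul, ← Complex.ofReal_sum, hS c.dir o k, Complex.ofReal_zero, zero_smul]

/-- **THE (0.4) BLOCK AVERAGE OF THE KERNEL LIFT IS `V` TO SECOND ORDER** (`SU(N)`, printed `exp[mean log]`): for a face-supported,
S-neutral table of row mass `≤ K₁` and a `δ`-small `V` with `K₁·2δ ≤ 1`, `8K₁δ ≤ 1/20`, `16 K₁ δ < δ_N` (and `δ ≤ 1/3`, `N·δ < π`),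
`‖Ū⋆(c) − V(c)‖ ≤ (2K₁δ)² + 28·(4K₁δ)²` for every coarse bond `c` (standing range). -/
theorem norm_avgFun_kernelLift_sub_le (hj : j + 1 ≤ P.m + P.K) (hF : FaceSupported R kz) (hS : SNeutral R kz) {K₁ δ : ℝ}
    (hK : RowMass R kz K₁) {V : GaugeField P (j + 1) (Matrix.specialUnitaryGroup n ℂ)} (hδ0 : 0 ≤ δ) (hV : PlaqSmall δ V)
    (hδ : δ ≤ 1 / 3) (hπ : Fintype.card n * δ < Real.pi) (hs1 : K₁ * (2 * δ) ≤ 1) (ht : 2 * (K₁ * (2 * δ)) ≤ 1 / 20)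
    (htδ : 2 * (2 * (K₁ * (2 * δ))) < deltaSU n) (c : PBond P (j + 1)) :
    ‖((avgFun (expMeanLogSU (n := n)) (kernelLift R kz V) c : Matrix.specialUnitaryGroup n ℂ) : Matrix n n ℂ) - (V c : Matrix n n ℂ)‖ ≤
      (K₁ * (2 * δ)) ^ 2 + 28 * (2 * (K₁ * (2 * δ))) ^ 2 := by
  have hζ : ∀ b, ‖zeta R kz V b‖ ≤ K₁ * (2 * δ) := norm_zeta_le hδ0 hV (hδ.trans (by norm_num)) hK
  have ht' : ∀ b, dist1 (corrE R kz V b) ≤ 2 * (K₁ * (2 * δ)) := fun b => dist1_corrE_le hV hδ hπ (hζ b) hs1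
  exact norm_avgFun_mulField_faceSec_sub_le_of_faceSum_eq_zero hj (exitSupported_corrE hF V) ht' ht htδ V c
    (fun r => zeta R kz V (exitBond c r)) (fun r => coe_corrE hV hδ hπ _) (fun r => hζ _) hs1 (faceSum_zeta_eq_zero hj hS V c)

/-- **THE ACCURACY CLAUSE OF `ApproxLiftStep` FOR THE KERNEL LIFT ON `SU(2)`** (`mdist` form, tree `ℰp`): under the same smallness
(`δ ≤ 1/3` and `16K₁δ ≤ 1/20` suffice), `mdist (V c) (Ū⋆(c)) ≤ 452·K₁²·δ²`. -/
theorem mdist_avgFun_kernelLift_le {R : ℕ}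
    {kz : Fin P.d → (Fin P.d → Fin P.L) → Orient P.d → (Fin P.d → Fin (2 * R + 1)) → ℝ}
    (hj : j + 1 ≤ P.m + P.K) (hF : FaceSupported R kz) (hS : SNeutral R kz) {K₁ δ : ℝ} (hK : RowMass R kz K₁)
    {V : GaugeField P (j + 1) (Matrix.specialUnitaryGroup (Fin 2) ℂ)} (hδ0 : 0 ≤ δ) (hV : PlaqSmall δ V) (hδ : δ ≤ 1 / 3)
    (ht : 16 * (K₁ * δ) ≤ 1 / 20) (c : PBond P (j + 1)) :
    MiddleBondRepair.mdist (V c) (avgFun (expMeanLogSU (n := Fin 2)) (kernelLift R kz V) c) ≤ 452 * K₁ ^ 2 * δ ^ 2 := by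
  have hπ : Fintype.card (Fin 2) * δ < Real.pi := by
    rw [Fintype.card_fin]; have := Real.pi_gt_three; push_cast; nlinarith
  have hs1 : K₁ * (2 * δ) ≤ 1 := by nlinarith
  have ht' : 2 * (K₁ * (2 * δ)) ≤ 1 / 20 := by nlinarith
  have htδ : 2 * (2 * (K₁ * (2 * δ))) < deltaSU (Fin 2) := by nlinarith [one_tenth_lt_deltaSU_two]
  unfold MiddleBondRepair.mdist
  rw [norm_sub_rev]
  refine (norm_avgFun_kernelLift_sub_le hj hF hS hK hδ0 hV hδ hπ hs1 ht' htδ c).trans (le_of_eq ?_)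
  ring

end Kernel

end Summit.QuantumFields.YangMills.Theorems.ApproxLift

end
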